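import Literature.AlgebraicGeometry.HodgeTheory.PicardLefschetzNodalForms
import Literature.AlgebraicGeometry.Motives.UniversalHypersurfaceBaseChart
import HarnessLib

/-!
# The unfolding plane `F_{u,v} = f₁ + u g + v h` of a pencil: classifying map and paths in its nonsingular locus

Family `hodge`, layer `Literature/AlgebraicGeometry/HodgeTheory`. Theorems only (programme «PL2-MERIDIANS», prover seat
`hodge-nonav-20241-p1` g18, cell `hodge-nonav`; `--supports stmt-HodgeConjecture-19716`). Small carriers for the final
assembly `PicardLefschetzExchangedPairOfOneNode`:

* `exists_planeMap` — the classifying map `(u,v) ↦ [f₁ + u g + v h]` of the nonsingular locus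
  `Ω = {(u,v) | f₁ + u g + v h nonsingular}` into `U(ℂ)`, continuous, with the prescribed forms (coefficient chart
  `pointOfCoeffs` of the base of the universal family);
* `ExchangedPairPlane.exists_circlePath` / `exists_subtypePath` / `exists_imagePath` — circles, paths of `ℂ²` inside `Ω`
  and images of paths under a continuous self-map of `ℂ²`, as paths of the subtype `↥Ω`.

## References

* [VoisinHodgeII2003] C. Voisin, Hodge Theory and Complex Algebraic Geometry II, CUP 2003, §2.3.1 (pencils), §3.1.2.
* [HatcherAT2002] A. Hatcher, Algebraic Topology, CUP 2002, §1.1.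
-/

noncomputable section

open CategoryTheory AlgebraicGeometry MvPolynomial
open _root_.Topology _root_.Filter
open scoped unitInterval
open Literature.AlgebraicGeometry.Motives Literature.AlgebraicGeometry.Motives.UniversalHypersurface
open Literature.AlgebraicGeometry.HodgeTheory.UniversalHypersurface

namespace Literature.AlgebraicGeometry.HodgeTheory

variable {n d : ℕ}

/-! ### §1 The classifying map of the plane `F_{u,v} = f₁ + u g + v h` -/

/-- **The classifying map of the unfolding plane**: on the nonsingular locus `Ω = {(u,v) | f₁ + u g + v h nonsingular}`,
`(u,v) ↦ [f₁ + u g + v h]` is a continuous map into `U(ℂ)` with the prescribed forms.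
[cite: VoisinHodgeII2003, §6.2.1] -/
theorem exists_planeMap {f₁ g h : MvPolynomial (Fin (n + 2)) ℂ} (hf₁ : f₁.IsHomogeneous d)
    (hg : g.IsHomogeneous d) (hh : h.IsHomogeneous d) :
    ∃ P : C(↥{q : ℂ × ℂ | SmoothHypersurface.IsNonsingularForm ℂ (f₁ + q.1 • g + q.2 • h)},
        ComplexPoints (base ℂ n d)),
      ∀ q, pointForm ℂ n d (P q) = f₁ + q.1.1 • g + q.1.2 • h := by
  set Ω := {q : ℂ × ℂ | SmoothHypersurface.IsNonsingularForm ℂ (f₁ + q.1 • g + q.2 • h)} with hΩ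
  let a : ↥Ω → DegIndex n d → ℂ := fun q m => coeff m.1 f₁ + q.1.1 * coeff m.1 g + q.1.2 * coeff m.1 h
  have hhom : ∀ q : ℂ × ℂ, (f₁ + q.1 • g + q.2 • h).IsHomogeneous d := fun q =>
    isHomogeneous_add_smul (isHomogeneous_add_smul hf₁ hg _) hh _
  have hform : ∀ q, formOfCoeffs (a q) = f₁ + q.1.1 • g + q.1.2 • h := fun q => by
    have h1 : a q = (fun m : DegIndex n d => coeff m.1 (f₁ + q.1.1 • g + q.1.2 • h)) :=
      funext fun m => by simp [a, coeff_add, coeff_smul, smul_eq_mul]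
    rw [h1, formOfCoeffs_coeff]
    exact hhom q.1
  have hJ : ∀ q, SmoothHypersurface.IsNonsingularForm ℂ (formOfCoeffs (a q)) := fun q => by
    rw [hform]; exact q.2
  have ha : Continuous a := continuous_pi fun m =>
    (continuous_const.add ((continuous_fst.comp continuous_subtype_val).mul continuous_const)).add
      ((continuous_snd.comp continuous_subtype_val).mul continuous_const)
  refine ⟨⟨fun q => pointOfCoeffs ℂ n d (a q) (hJ q), continuous_pointOfCoeffs_comp ℂ n d ha hJ⟩, fun q => ?_⟩
  change pointForm ℂ n d (pointOfCoeffs ℂ n d (a q) (hJ q)) = _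
  rw [pointForm_pointOfCoeffs, hform]


/-! ### §2 Paths in the nonsingular locus of the plane -/

namespace ExchangedPairPlane

variable {Ω : Set (ℂ × ℂ)}

/-- A circle `θ ↦ c + (r e^{2πiθ}, 0)` lying in `Ω`, as a loop of `↥Ω`. [cite: HatcherAT2002, §1.1 (paths and the fundamental group)] -/
theorem exists_circlePath (c : ℂ × ℂ) (r : ℝ)
    (hmem : ∀ θ : ℝ, c + (((r : ℂ) * Complex.exp (2 * Real.pi * Complex.I * (θ : ℂ))), (0 : ℂ)) ∈ Ω) :
    ∃ (x : ↥Ω) (μ : Path x x), (x : ℂ × ℂ) = c + ((r : ℂ), 0) ∧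
      ∀ θ : I, (μ θ : ℂ × ℂ) = c + (((r : ℂ) * Complex.exp (2 * Real.pi * Complex.I * ((θ : ℝ) : ℂ))), 0) := by
  have h0 : c + (((r : ℂ) * Complex.exp (2 * Real.pi * Complex.I * ((0 : ℝ) : ℂ))), (0 : ℂ)) = c + ((r : ℂ), 0) := by
    simp
  have h1 : c + (((r : ℂ) * Complex.exp (2 * Real.pi * Complex.I * ((1 : ℝ) : ℂ))), (0 : ℂ)) = c + ((r : ℂ), 0) := by
    rw [Complex.ofReal_one, mul_one, Complex.exp_two_pi_mul_I, mul_one]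
  let f : I → ↥Ω := fun θ => ⟨c + (((r : ℂ) * Complex.exp (2 * Real.pi * Complex.I * ((θ : ℝ) : ℂ))), 0), hmem θ⟩
  have hf : Continuous f := by
    refine Continuous.subtype_mk ?_ _
    refine continuous_const.add (Continuous.prodMk ?_ continuous_const)
    exact continuous_const.mul (Complex.continuous_exp.comp
      (continuous_const.mul (Complex.continuous_ofReal.comp continuous_subtype_val)))
  refine ⟨⟨c + ((r : ℂ), 0), h0 ▸ hmem 0⟩, ⟨⟨f, hf⟩, ?_, ?_⟩, rfl, fun θ => rfl⟩
  · exact Subtype.ext h0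
  · exact Subtype.ext h1

/-- A path of `ℂ²` with values in `Ω`, as a path of `↥Ω`. [cite: HatcherAT2002, §1.1 (paths and the fundamental group)] -/
theorem exists_subtypePath {x y : ℂ × ℂ} (γ : Path x y) (hγ : ∀ t, γ t ∈ Ω) :
    ∃ γ' : Path (⟨x, by simpa using hγ 0⟩ : ↥Ω) ⟨y, by simpa using hγ 1⟩, ∀ t, (γ' t : ℂ × ℂ) = γ t :=
  ⟨⟨⟨fun t => ⟨γ t, hγ t⟩, γ.continuous.subtype_mk _⟩, Subtype.ext (by simp), Subtype.ext (by simp)⟩, fun _ => rfl⟩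

/-- The image of a path of `↥Ω` under a continuous map `ι : ℂ² → ℂ²` with `ι (values) ∈ Ω`, as a path of `↥Ω`.
[cite: HatcherAT2002, §1.1 (induced homomorphisms)] -/
theorem exists_imagePath {ι : ℂ × ℂ → ℂ × ℂ} (hι : Continuous ι) {x y : ↥Ω} (γ : Path x y)
    (hγ : ∀ t, ι (γ t : ℂ × ℂ) ∈ Ω) :
    ∃ γ' : Path (⟨ι x, by simpa using hγ 0⟩ : ↥Ω) ⟨ι y, by simpa using hγ 1⟩, ∀ t, (γ' t : ℂ × ℂ) = ι (γ t) :=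
  ⟨⟨⟨fun t => ⟨ι (γ t), hγ t⟩, (hι.comp (continuous_subtype_val.comp γ.continuous)).subtype_mk _⟩,
    Subtype.ext (by simp), Subtype.ext (by simp)⟩, fun _ => rfl⟩

end ExchangedPairPlane

end Literature.AlgebraicGeometry.HodgeTheory

end
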